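import Summits.BirchSwinnertonDyer.BirchSwinnertonDyer.Theorems.ResidualThetaTransportAtTwoThetaLayerLambdaCongruenceAtTwoCuspSpanFourInvariancePrimePow
import HarnessLib

/-!
# Route `ResidualThetaTransportAtTwo`, cruxes Kan⁺ (stmt-BirchSwinnertonDyer-20688) / 21437, node `CuspSpanEvenAtTwo N`:
# THREE-FOLD `B₁`-PRODUCTS at an arbitrary level `N` — the exact lower-right entry and the witness form of the relation
# `χ β₁ + χ β₂ + χ β₃ = 0`

Cell `bsd-wall`, width seat `bsd-wall-rtt-p3-w4` g2 (2026-08-28), lane «3-fold B₁-products at prime-power and composite level»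
(the prime-level version of the device is `bsd-wall-rtt-p3-w2` g4's «q-adic triangles»; nothing here is prime-specific).
THEOREMS ONLY; `--supports stmt-BirchSwinnertonDyer-20688`; BSD is not proved by this.

For `b = −1` elements `βᵢ = (αᵢ, −1; cᵢ, δᵢ)` of `Γ₀(N)` (`cᵢ = 1 − αᵢδᵢ`):
* §1 `triple_apply_one_one` — `(β₁β₂β₃)₁₁ = −δ₁ + D (α₂ + δ₃)` with `D := (β₁β₂)₁₁ = δ₁(α₁ + δ₂) − 1` (and `(β₁β₂)₁₀ = δ₁ − α₂ D`).
* §2 `chi_add_chi_add_chi_eq_zero_of_witness` — for an additive `χ : Γ₀(N) → 𝔽₂` killing the small-trace elements and the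
  elements with lower-right entry `±4^K` (`K ≥ 1`), and `b = −1` elements `β₁, β₂, β₃` whose `d`-residues are `n`, `s − α₁`, `δ₃`
  for integers with `N ∣ 1 − α₁ n`, `N ∣ 1 − α₂ (s − α₁)` and `−n + (n s − 1)(α₂ + δ₃) = ±4^K`: `χ β₁ + χ β₂ + χ β₃ = 0`
  (replace the `βᵢ` by the explicit elements with these entries — same `χ`-values by `chi_eq_of_apply_zero_one_eq_neg_one` — whose
  product has lower-right entry `±4^K` exactly). In terms of the `B₁`-character `F(d mod N) := χ(β)`: `F(u) + F(v) + F(w) = 0` with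
  `u v w ≡ ±4^K`; the arithmetic supply of such witnesses (an auxiliary Dirichlet prime `n`, `D = −q^t`) is the sequel
  `…CuspSpanTriangleNRelation`.

References: [Rademacher1929] §1 (generators of `Γ₀(N)`); [Pollack2003] Conj. 6.3 (the node); [Manin1972] §1.5.
-/

set_option autoImplicit false
set_option linter.dupNamespace false

open scoped MatrixGroups

open CongruenceSubgroup

namespace Summit.BirchSwinnertonDyer.BirchSwinnertonDyer.Theorems.SignedMuAtTwo.TriangleN

variable {N : ℕ} {χ : Gamma0 N → ZMod 2}

/-! ## §1. Entries of two- and three-fold products of `b = −1` elements -/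

/-- Lower-left entry of a `b = −1` element: `c = 1 − a d`. [folklore] -/
theorem apply_one_zero_of_b_neg_one (β : Gamma0 N) (hb : (β : SL(2, ℤ)) 0 1 = -1) :
    (β : SL(2, ℤ)) 1 0 = 1 - (β : SL(2, ℤ)) 0 0 * (β : SL(2, ℤ)) 1 1 := by
  have hdet := Matrix.SpecialLinearGroup.det_coe (β : SL(2, ℤ))
  rw [Matrix.det_fin_two, hb] at hdet
  linear_combination hdet

/-- `(β₁β₂)₁₁ = d₁(a₁ + d₂) − 1` for `b = −1` elements. [folklore] -/
theorem double_apply_one_one (β₁ β₂ : Gamma0 N) (hb1 : (β₁ : SL(2, ℤ)) 0 1 = -1) (hb2 : (β₂ : SL(2, ℤ)) 0 1 = -1) :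
    ((β₁ * β₂ : Gamma0 N) : SL(2, ℤ)) 1 1 =
      (β₁ : SL(2, ℤ)) 1 1 * ((β₁ : SL(2, ℤ)) 0 0 + (β₂ : SL(2, ℤ)) 1 1) - 1 := by
  rw [gamma0_mul_apply_one_one', apply_one_zero_of_b_neg_one β₁ hb1, hb2]; ring

/-- `(β₁β₂)₁₀ = d₁ − a₂ · (β₁β₂)₁₁` for `b = −1` elements. [folklore] -/
theorem double_apply_one_zero (β₁ β₂ : Gamma0 N) (hb1 : (β₁ : SL(2, ℤ)) 0 1 = -1) (hb2 : (β₂ : SL(2, ℤ)) 0 1 = -1) :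
    ((β₁ * β₂ : Gamma0 N) : SL(2, ℤ)) 1 0 =
      (β₁ : SL(2, ℤ)) 1 1 - (β₂ : SL(2, ℤ)) 0 0 *
        ((β₁ : SL(2, ℤ)) 1 1 * ((β₁ : SL(2, ℤ)) 0 0 + (β₂ : SL(2, ℤ)) 1 1) - 1) := by
  rw [ThetaLayerLambdaCongruenceAtTwo.gamma0_mul_apply_one_zero, apply_one_zero_of_b_neg_one β₁ hb1,
    apply_one_zero_of_b_neg_one β₂ hb2]; ring

/-- **`(β₁β₂β₃)₁₁ = −d₁ + D (a₂ + d₃)`, `D = d₁(a₁ + d₂) − 1`,** for `b = −1` elements `β₁, β₂, β₃ ∈ Γ₀(N)`. [folklore] -/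
theorem triple_apply_one_one (β₁ β₂ β₃ : Gamma0 N) (hb1 : (β₁ : SL(2, ℤ)) 0 1 = -1) (hb2 : (β₂ : SL(2, ℤ)) 0 1 = -1)
    (hb3 : (β₃ : SL(2, ℤ)) 0 1 = -1) :
    ((β₁ * β₂ * β₃ : Gamma0 N) : SL(2, ℤ)) 1 1 =
      -(β₁ : SL(2, ℤ)) 1 1 +
        ((β₁ : SL(2, ℤ)) 1 1 * ((β₁ : SL(2, ℤ)) 0 0 + (β₂ : SL(2, ℤ)) 1 1) - 1) *
          ((β₂ : SL(2, ℤ)) 0 0 + (β₃ : SL(2, ℤ)) 1 1) := by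
  rw [gamma0_mul_apply_one_one', double_apply_one_zero β₁ β₂ hb1 hb2, double_apply_one_one β₁ β₂ hb1 hb2, hb3]; ring

/-! ## §2. The relation from an arithmetic witness -/

/-- A `b = −1` element with prescribed `a` and `d` (`N ∣ 1 − a d`). [folklore] -/
theorem exists_b_neg_one_entries [NeZero N] (a d : ℤ) (h : (N : ℤ) ∣ 1 - a * d) :
    ∃ β : Gamma0 N, (β : SL(2, ℤ)) 0 0 = a ∧ (β : SL(2, ℤ)) 0 1 = -1 ∧ (β : SL(2, ℤ)) 1 1 = d := by
  obtain ⟨β, h00, h01, -, h11⟩ :=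
    ThetaLayerLambdaCongruenceAtTwo.exists_gamma0_entries (N := N) a (-1) (1 - a * d) d (by ring) h
  exact ⟨β, h00, h01, h11⟩

/-- **The three-fold relation from an arithmetic witness.** Let `χ : Γ₀(N) → 𝔽₂` be additive, kill the elements of trace
`0, ±1, ±2` and the elements with lower-right entry `±4^K` (`K ≥ 1`), `N` prime to `4`. Let `β₁, β₂, β₃` be `b = −1` elements
whose `d`-residues mod `N` are `n`, `s − α₁`, `δ₃` for integers with `N ∣ 1 − α₁ n`, `N ∣ 1 − α₂ (s − α₁)` and
`−n + (n s − 1)(α₂ + δ₃) = ε 4^K`, `ε = ±1`, `K ≥ 1`. Then `χ β₁ + χ β₂ + χ β₃ = 0`. (The explicit elements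
`(α₁, −1; ·, n)`, `(α₂, −1; ·, s − α₁)`, `(α₃, −1; ·, δ₃)` have the same `χ`-values and their product has lower-right entry `ε4^K`,
`triple_apply_one_one`; `δ₃` is prime to `N` because `(n s − 1) δ₃ ≡ ε 4^K`.) [cite: Pollack2003, Conj. 6.3] -/
theorem chi_add_chi_add_chi_eq_zero_of_witness [NeZero N] (hN4 : IsCoprime (4 : ℤ) N)
    (hadd : ∀ γ δ : Gamma0 N, χ (γ * δ) = χ γ + χ δ)
    (hsmall : ∀ γ : Gamma0 N, ((γ : SL(2, ℤ)) 0 0 + (γ : SL(2, ℤ)) 1 1).natAbs ≤ 2 → χ γ = 0)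
    (hkill : ∀ γ : Gamma0 N, (∃ k : ℕ, 1 ≤ k ∧ ((γ : SL(2, ℤ)) 1 1).natAbs = 4 ^ k) → χ γ = 0)
    {β₁ β₂ β₃ : Gamma0 N} (hb1 : (β₁ : SL(2, ℤ)) 0 1 = -1) (hb2 : (β₂ : SL(2, ℤ)) 0 1 = -1)
    (hb3 : (β₃ : SL(2, ℤ)) 0 1 = -1)
    (n s α₁ α₂ δ₃ ε : ℤ) (K : ℕ) (hK : 1 ≤ K) (hε : ε = 1 ∨ ε = -1)
    (h1 : ((((β₁ : SL(2, ℤ)) 1 1 : ℤ) : ZMod N)) = (n : ZMod N))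
    (h2 : ((((β₂ : SL(2, ℤ)) 1 1 : ℤ) : ZMod N)) = ((s - α₁ : ℤ) : ZMod N))
    (h3 : ((((β₃ : SL(2, ℤ)) 1 1 : ℤ) : ZMod N)) = (δ₃ : ZMod N))
    (hα₁ : (N : ℤ) ∣ 1 - α₁ * n) (hα₂ : (N : ℤ) ∣ 1 - α₂ * (s - α₁))
    (hfinal : -n + (n * s - 1) * (α₂ + δ₃) = ε * 4 ^ K) :
    χ β₁ + χ β₂ + χ β₃ = 0 := by
  -- residues
  have e1 : (α₁ : ZMod N) * (n : ZMod N) = 1 := by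
    have := (ZMod.intCast_zmod_eq_zero_iff_dvd _ N).mpr hα₁
    push_cast at this; linear_combination -this
  have e2 : (α₂ : ZMod N) * ((s : ZMod N) - (α₁ : ZMod N)) = 1 := by
    have := (ZMod.intCast_zmod_eq_zero_iff_dvd _ N).mpr hα₂
    push_cast at this; linear_combination -this
  have eD : ((n : ZMod N) * (s : ZMod N) - 1) * (δ₃ : ZMod N) = (ε : ZMod N) * 4 ^ K := by
    have hf : ((-n + (n * s - 1) * (α₂ + δ₃) : ℤ) : ZMod N) = ((ε * 4 ^ K : ℤ) : ZMod N) := by rw [hfinal]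
    push_cast at hf
    linear_combination hf - (n : ZMod N) * e2 - (α₂ : ZMod N) * e1
  -- `δ₃` is a unit mod `N`
  have hε' : IsUnit (ε : ZMod N) := by
    rcases hε with rfl | rfl
    · simp
    · push_cast; exact isUnit_one.neg
  have h4 : IsUnit ((4 : ZMod N) ^ K) := by
    have h4u : IsUnit ((4 : ℤ) : ZMod N) := (ZMod.coe_int_isUnit_iff_isCoprime 4 N).mpr hN4.symm
    push_cast at h4u
    exact h4u.pow K
  have hδ₃u : IsUnit (δ₃ : ZMod N) := by
    have hu : IsUnit (((n : ZMod N) * (s : ZMod N) - 1) * (δ₃ : ZMod N)) := by rw [eD]; exact hε'.mul h4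
    exact isUnit_of_mul_isUnit_right hu
  obtain ⟨α₃, t, h3cop⟩ : IsCoprime δ₃ (N : ℤ) := ((ZMod.coe_int_isUnit_iff_isCoprime δ₃ N).mp hδ₃u).symm
  -- the explicit elements
  obtain ⟨γ₁, g100, g101, g111⟩ := exists_b_neg_one_entries (N := N) α₁ n hα₁
  obtain ⟨γ₂, g200, g201, g211⟩ := exists_b_neg_one_entries (N := N) α₂ (s - α₁) hα₂
  obtain ⟨γ₃, -, g301, g311⟩ := exists_b_neg_one_entries (N := N) α₃ δ₃ ⟨t, by linear_combination -h3cop⟩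
  have c1 : χ β₁ = χ γ₁ := chi_eq_of_apply_zero_one_eq_neg_one hadd hsmall hb1 g101 (by rw [h1, g111])
  have c2 : χ β₂ = χ γ₂ := chi_eq_of_apply_zero_one_eq_neg_one hadd hsmall hb2 g201 (by rw [h2, g211])
  have c3 : χ β₃ = χ γ₃ := chi_eq_of_apply_zero_one_eq_neg_one hadd hsmall hb3 g301 (by rw [h3, g311])
  -- the product has lower-right entry `ε 4^K`
  have hprod : ((γ₁ * γ₂ * γ₃ : Gamma0 N) : SL(2, ℤ)) 1 1 = ε * 4 ^ K := by
    rw [triple_apply_one_one γ₁ γ₂ γ₃ g101 g201 g301, g111, g100, g211, g200, g311, ← hfinal]; ring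
  have hk : χ (γ₁ * γ₂ * γ₃) = 0 := by
    refine hkill _ ⟨K, hK, ?_⟩
    rw [hprod, Int.natAbs_mul, Int.natAbs_pow]
    rcases hε with rfl | rfl <;> simp
  rw [c1, c2, c3, ← hadd, ← hadd, hk]

/-- **Residue form.** Same hypotheses; conclusion phrased for ANY `b = −1` elements `β₁, β₂, β₃` with `d`-residues `u, v, w` where
`u = n`, `v = s − α₁` and `u v w = ε 4^K` in `ZMod N` (the third residue is forced: `(ns − 1) δ₃ ≡ ε4^K` and `ns − 1 ≡ u v`).
[cite: Pollack2003, Conj. 6.3] -/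
theorem chi_add_chi_add_chi_eq_zero_of_witness' [NeZero N] (hN4 : IsCoprime (4 : ℤ) N)
    (hadd : ∀ γ δ : Gamma0 N, χ (γ * δ) = χ γ + χ δ)
    (hsmall : ∀ γ : Gamma0 N, ((γ : SL(2, ℤ)) 0 0 + (γ : SL(2, ℤ)) 1 1).natAbs ≤ 2 → χ γ = 0)
    (hkill : ∀ γ : Gamma0 N, (∃ k : ℕ, 1 ≤ k ∧ ((γ : SL(2, ℤ)) 1 1).natAbs = 4 ^ k) → χ γ = 0)
    {β₁ β₂ β₃ : Gamma0 N} (hb1 : (β₁ : SL(2, ℤ)) 0 1 = -1) (hb2 : (β₂ : SL(2, ℤ)) 0 1 = -1)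
    (hb3 : (β₃ : SL(2, ℤ)) 0 1 = -1)
    (n s α₁ α₂ δ₃ ε : ℤ) (K : ℕ) (hK : 1 ≤ K) (hε : ε = 1 ∨ ε = -1)
    (h1 : ((((β₁ : SL(2, ℤ)) 1 1 : ℤ) : ZMod N)) = (n : ZMod N))
    (h2 : ((((β₂ : SL(2, ℤ)) 1 1 : ℤ) : ZMod N)) = ((s - α₁ : ℤ) : ZMod N))
    (h3 : ((((β₁ : SL(2, ℤ)) 1 1 : ℤ) : ZMod N)) * ((((β₂ : SL(2, ℤ)) 1 1 : ℤ) : ZMod N)) *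
      ((((β₃ : SL(2, ℤ)) 1 1 : ℤ) : ZMod N)) = (ε : ZMod N) * 4 ^ K)
    (hα₁ : (N : ℤ) ∣ 1 - α₁ * n) (hα₂ : (N : ℤ) ∣ 1 - α₂ * (s - α₁))
    (hfinal : -n + (n * s - 1) * (α₂ + δ₃) = ε * 4 ^ K) :
    χ β₁ + χ β₂ + χ β₃ = 0 := by
  have e1 : (α₁ : ZMod N) * (n : ZMod N) = 1 := by
    have := (ZMod.intCast_zmod_eq_zero_iff_dvd _ N).mpr hα₁
    push_cast at this; linear_combination -this
  have e2 : (α₂ : ZMod N) * ((s : ZMod N) - (α₁ : ZMod N)) = 1 := by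
    have := (ZMod.intCast_zmod_eq_zero_iff_dvd _ N).mpr hα₂
    push_cast at this; linear_combination -this
  have eD : ((n : ZMod N) * (s : ZMod N) - 1) * (δ₃ : ZMod N) = (ε : ZMod N) * 4 ^ K := by
    have hf : ((-n + (n * s - 1) * (α₂ + δ₃) : ℤ) : ZMod N) = ((ε * 4 ^ K : ℤ) : ZMod N) := by rw [hfinal]
    push_cast at hf
    linear_combination hf - (n : ZMod N) * e2 - (α₂ : ZMod N) * e1
  -- `u v = n s − 1`, so `d(β₃) ≡ δ₃`
  have huv : ((((β₁ : SL(2, ℤ)) 1 1 : ℤ) : ZMod N)) * ((((β₂ : SL(2, ℤ)) 1 1 : ℤ) : ZMod N)) =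
      (n : ZMod N) * (s : ZMod N) - 1 := by
    rw [h1, h2]; push_cast; linear_combination -e1
  have hDu : IsUnit ((n : ZMod N) * (s : ZMod N) - 1) := by
    rw [← huv]; exact (isUnit_gamma0_apply_one_one β₁).mul (isUnit_gamma0_apply_one_one β₂)
  have h3' : ((((β₃ : SL(2, ℤ)) 1 1 : ℤ) : ZMod N)) = (δ₃ : ZMod N) := by
    rw [huv] at h3
    have e : ((n : ZMod N) * (s : ZMod N) - 1) * ((((β₃ : SL(2, ℤ)) 1 1 : ℤ) : ZMod N)) =
        ((n : ZMod N) * (s : ZMod N) - 1) * (δ₃ : ZMod N) := by rw [h3, eD]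
    exact hDu.mul_left_cancel e
  exact chi_add_chi_add_chi_eq_zero_of_witness hN4 hadd hsmall hkill hb1 hb2 hb3 n s α₁ α₂ δ₃ ε K hK hε h1 h2 h3'
    hα₁ hα₂ hfinal

end Summit.BirchSwinnertonDyer.BirchSwinnertonDyer.Theorems.SignedMuAtTwo.TriangleN
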